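import Summits.QuantumAdvantage.QuantumAdvantage.Statement
import Literature.Computability.QuantumComplexity.BQPContainmentsProofs
import Literature.Computability.QuantumComplexity.BQPCollapsingOracle
import Literature.Computability.Complexity.SpaceProofs
import Literature.Computability.Complexity.ProbabilisticClassesProofs
import Literature.Computability.Complexity.AlgebrizationBarriersProofs
import HarnessLib

/-!
# The ceiling of `QuantumAdvantage`: unconditional consequences and the failure of its
# relativised and algebrised analogues

`QuantumAdvantage` is `∃ L, L ∈ BQP ∧ L ∉ BPP`. This file records, as sorry-free theorems over the
tree's *discharged* sandwich `P ⊆ BPP ⊆ BQP ⊆ PP ⊆ PSPACE ⊆ EXP`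
(`P_subset_BPP_holds`, `BPP_subset_BQP_holds`, `BQP_subset_PP_holds`, `PP_subset_PSPACE_holds`,
`PSPACE_subset_EXP_holds`), what any proof of the summit proves *a fortiori*:

* `¬ PP ⊆ BPP`, `BPP ≠ PP`, `P ≠ PP`;
* `¬ PSPACE ⊆ BPP`, `BPP ≠ PSPACE`, `P ≠ PSPACE`;
* `¬ EXP ⊆ BPP`, `BPP ≠ EXP`

— every one of them an open separation (Arora–Barak 2009, §7.5.2 "BPP = EXP?" is open; §4.1, §5
`P` vs `PSPACE`; §17.2 `PP`). By Impagliazzo–Wigderson (FOCS 1998, Thm. 2) `EXP ≠ BPP` is already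
equivalent to an infinitely-often average-case subexponential derandomisation of `BPP`; so a proof
of the summit contains, at the very least, an unconditional uniform derandomisation theorem.

It also restates in summit form the two *collapses* proved in the Literature library, which say
that the relativised and the algebrised analogues of the summit statement are false somewhere:

* `soloBlind_relativised_analogue_fails`: `∃ A, ¬ ∃ L, L ∈ BQP^A ∧ L ∉ BPP^A`
  (Ko-type self-encoding oracle, `exists_oracle_BQPRel_subset_BPPRel'`; printed form: any
  `PSPACE`-complete oracle, Fortnow–Rogers 1999 Thm. 4.2, Bernstein–Vazirani 1997 Thm. 8.4);
* `soloBlind_algebrised_analogue_fails`: `∃ A Ã, Ã` a multilinear extension of `A` and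
  `¬ ∃ L, L ∈ BQP^Ã ∧ L ∉ BPP^A` (Aaronson–Wigderson 2009, Thm. 5.2 instance,
  `aaronsonWigderson2009_bqp_subset_bpp_collapse_holds`).

Hence (meta-theoretically) no relativising and no algebrising argument proves `QuantumAdvantage`.
Nothing here is progress towards the summit; it is the kernel-checked form of its ceiling.

References: E. Bernstein, U. Vazirani, SIAM J. Comput. 26 (1997), §8; L. Adleman, J. DeMarrais,
M.-D. Huang, SIAM J. Comput. 26 (1997), Thm. 6.4; L. Fortnow, J. Rogers, JCSS 59 (1999), Thm. 4.2;
S. Aaronson, A. Wigderson, ACM TOCT 1 (2009), Thm. 5.2, Def. 2.3; R. Impagliazzo, A. Wigderson,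
*Randomness vs. time: de-randomization under a uniform assumption*, FOCS 1998, Thm. 2;
S. Arora, B. Barak, *Computational Complexity* (2009), §7.5.2, §20.
-/

namespace Summit.QuantumAdvantage.QuantumAdvantage.Theorems

open Literature.Computability.Complexity Literature.Computability.Complexity.Classes
  Literature.Computability.Cryptography Literature.Computability.QuantumComplexity

/-- The summit is literally "`BQP` is not contained in `BPP`" (the witness form unfolds to the
negated inclusion; no fact needed). -/
theorem soloBlind_quantumAdvantage_iff_not_subset :
    _root_.QuantumAdvantage ↔ ¬ (BQP ⊆ BPP) := by
  show (∃ L : Language Bool, L ∈ BQP ∧ L ∉ BPP) ↔ ¬ (BQP ⊆ BPP)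
  constructor
  · rintro ⟨L, hL, hL'⟩ hsub
    exact hL' (hsub hL)
  · intro h
    by_contra hne
    exact h fun L hL => by
      by_contra hL'
      exact hne ⟨L, hL, hL'⟩

/-- Any class containing `BQP` is not contained in `BPP` if the summit holds. -/
theorem soloBlind_not_subset_BPP_of_BQP_subset {C : Set (Language Bool)} (hC : BQP ⊆ C)
    (h : _root_.QuantumAdvantage) : ¬ (C ⊆ BPP) := fun hCB =>
  (soloBlind_quantumAdvantage_iff_not_subset.1 h) (hC.trans hCB)

/-- Summit ⇒ `PP ⊄ BPP` (via the discharged `BQP ⊆ PP`, Adleman–DeMarrais–Huang 1997). -/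
theorem soloBlind_not_PP_subset_BPP (h : _root_.QuantumAdvantage) : ¬ (PP ⊆ BPP) :=
  soloBlind_not_subset_BPP_of_BQP_subset BQP_subset_PP_holds h

/-- Summit ⇒ `BPP ≠ PP`. -/
theorem soloBlind_BPP_ne_PP (h : _root_.QuantumAdvantage) : BPP ≠ PP := fun he =>
  soloBlind_not_PP_subset_BPP h he.ge

/-- Summit ⇒ `P ≠ PP` (if `P = PP` then `BQP ⊆ PP = P ⊆ BPP`). -/
theorem soloBlind_P_ne_PP (h : _root_.QuantumAdvantage) : P ≠ PP := fun he =>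
  soloBlind_not_PP_subset_BPP h (he.ge.trans P_subset_BPP_holds)

/-- Summit ⇒ `PSPACE ⊄ BPP` (via the discharged `BQP ⊆ PSPACE`, Bernstein–Vazirani 1997, Thm. 8.4). -/
theorem soloBlind_not_PSPACE_subset_BPP (h : _root_.QuantumAdvantage) : ¬ (PSPACE ⊆ BPP) :=
  soloBlind_not_subset_BPP_of_BQP_subset BQP_subset_PSPACE_holds h

/-- Summit ⇒ `BPP ≠ PSPACE`. -/
theorem soloBlind_BPP_ne_PSPACE (h : _root_.QuantumAdvantage) : BPP ≠ PSPACE := fun he =>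
  soloBlind_not_PSPACE_subset_BPP h he.ge

/-- Summit ⇒ `P ≠ PSPACE` (if `P = PSPACE` then `BQP ⊆ PSPACE = P ⊆ BPP`). -/
theorem soloBlind_P_ne_PSPACE (h : _root_.QuantumAdvantage) : P ≠ PSPACE := fun he =>
  soloBlind_not_PSPACE_subset_BPP h (he.ge.trans P_subset_BPP_holds)

/-- Summit ⇒ `EXP ⊄ BPP` (via `BQP ⊆ PSPACE ⊆ EXP`; `EXP ⊄ BPP` is open, Arora–Barak 2009 §7.5.2,
and is equivalent to an i.o. average-case subexponential derandomisation of `BPP`,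
Impagliazzo–Wigderson 1998). -/
theorem soloBlind_not_EXP_subset_BPP (h : _root_.QuantumAdvantage) : ¬ (EXP ⊆ BPP) :=
  soloBlind_not_subset_BPP_of_BQP_subset
    (fun _ hL => PSPACE_subset_EXP_holds (BQP_subset_PSPACE_holds hL)) h

/-- Summit ⇒ `BPP ≠ EXP`. -/
theorem soloBlind_BPP_ne_EXP (h : _root_.QuantumAdvantage) : BPP ≠ EXP := fun he =>
  soloBlind_not_EXP_subset_BPP h he.ge

/-- **The relativised analogue of the summit fails at some oracle**: there is a language oracle
`A` with no `L ∈ BQP^A ∖ BPP^A` (the tree's Ko-type collapsing oracle; printed: any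
`PSPACE`-complete `A`, Fortnow–Rogers 1999, Thm. 4.2). So no relativising argument proves
`QuantumAdvantage`. -/
theorem soloBlind_relativised_analogue_fails :
    ∃ A : Language Bool, ¬ ∃ L : Language Bool, L ∈ BQPRel A ∧ L ∉ BPPRel (Oracle.ofLanguage A) := by
  obtain ⟨A, hA⟩ := exists_oracle_BQPRel_subset_BPPRel'
  exact ⟨A, fun ⟨L, hL, hL'⟩ => hL' (hA hL)⟩

/-- **The algebrised analogue of the summit fails at some oracle pair**: there are a language
oracle `A` and a multilinear extension `Ã` of `A` with no `L ∈ BQP^Ã ∖ BPP^A`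
(Aaronson–Wigderson 2009, Thm. 5.2 instance; AW Def. 2.3). So no algebrising argument proves
`QuantumAdvantage`. -/
theorem soloBlind_algebrised_analogue_fails :
    ∃ (A : Language Bool) (Ã : ExtensionOracle), Ã.IsExtensionOf A 1 ∧
      ¬ ∃ L : Language Bool,
        L ∈ BQPRel (Oracle.bitLanguage Ã.toOracle) ∧ L ∉ BPPRel (Oracle.ofLanguage A) := by
  obtain ⟨A, Ã, hÃ, hsub⟩ := aaronsonWigderson2009_bqp_subset_bpp_collapse_holds
  exact ⟨A, Ã, hÃ, fun ⟨L, hL, hL'⟩ => hL' (hsub hL)⟩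

end Summit.QuantumAdvantage.QuantumAdvantage.Theorems
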